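/-
Copyright (c) 2026 the pub-hodgecm-mathlib formalisation cell (harness21).  Prover seat hodgecm-mathlib-K2E1-p11 (g6), Track B ∕ K2-LIT, h413 = `stmt-HodgeConjecture-24833`,
R90-TF section S8 «ContSpec-n½», the `hsrc` supplier estate, census `R90/S8/CENSUS-UnfoldingLetterFree.K2E1-p11-g6.md` f7bfa6fc755d5846 item «base-point element» (S8 dealer
R90-CS-plan (g4), S8-R266 (6)): THE MOVED BASE POINT `ι_f(w₀^{S₀}) ∈ U(2,1)(𝔸_{L⁺,f})` EXISTS — component `Φ₃` at the places of `S₀`, `1` elsewhere, integral (`∈ U(𝒪̂)`, hence `ι_f(·) ∈ K_max`)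
— the base point whose per-place components ★ p865059 (`= Φ₃`) and ★ p865184 ∕ ★ p865317 (`= 1`) read.
-/
import Summits.HodgeConjecture.HodgeConjecture.Theorems.K2E1ChiGoodInertReadingU3          -- ★ p865184 (this seat): `mem_local_of_mem_cmLocalForm`, `coe_localGLPiEquiv_apply`, `localGLPiEquiv_apply_mem_valuedCongruenceSubgroup_one`; brings ★ `exists_antidiag`, `antidiag_mem_integralLevel`, ★ p864759
import Summits.HodgeConjecture.HodgeConjecture.Theorems.R90S8ChiSectionPairLevelOfRecordU3   -- ★ p863976 (K2E1-p11 (g4)): `adelicVal_finAdelicToAdelic_mem_standardMaximalCompactGL` (`ι_f(U(𝒪̂)) ⊆ K_max`)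
import HarnessLib

/-!
# K2·E1 ∕ R90·S8 — `K2E1ChiMovedBasePointU3`: THE MOVED BASE POINT `ι_f(w₀^{S₀})` — a finite-adelic point of `U(2,1)` with component `Φ₃` at every place of `S₀` and `1` off `S₀`,
# integral (so `ι_f(w₀^{S₀}) ∈ K_max`): the base point of ★ p864821's `hsrc` row, whose components the per-place readings ★ p865059 ∕ ★ p865184 ∕ ★ p865317 consume

Cell `pub/hodgecm-mathlib`, crux h413 = `stmt-HodgeConjecture-24833`, route of record `HCCMUnconditional`; R90-TF section S8 «ContSpec-n½», road R2-χ₃ ((V)∕(R)′ OF RECORD row `hsrc` at the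
MOVED base point `g₁ = ι_f(w₀^{S₀})`, F-A32 (R1)).  THEOREMS ONLY (no `def`, no `instance`, no `notation`, no named-fact hypothesis, no `sorry`; default heartbeats); lane
`--supports stmt-HodgeConjecture-24833 --as helper` (count-neutral).  Closes no socket.

THE MATHEMATICS ([PlatonovRapinchuk1994] §5.1; [BorelJacquet1979] §4.1; [Rogawski1990] §1.10 p. 9).  `U(2,1)(𝔸_{L⁺,f}) = ∏'_v U(2,1)(L⁺_v)` (★ `finAdelicEquiv`).  At every finite place `v`
of `L⁺` the long Weyl element `Φ₃ = antidiag(1,1,1)` is a point of `U(Φ₃)(L⁺_v)` (★ `exists_antidiag`) lying in `U(𝒪_v)` (★ `antidiag_mem_integralLevel`; transported to `localPi v` by ★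
p865184 §1).  For a finite set `S₀` the family `(Φ₃)_{v ∈ S₀} × (1)_{v ∉ S₀}` is integral at EVERY `v`, hence a point `w₀^{S₀}` of the restricted product (★ `RestrictedProduct.mk`), with
`evalPlace v w₀^{S₀} = Φ₃` (`v ∈ S₀`), `= 1` (`v ∉ S₀`) (★ p864759 `evalPlace_finAdelicEquiv_symm`), `w₀^{S₀} ∈ U(𝒪̂)` (★ `mem_finAdelicIntegralLevel_iff_forall`) and so `ι_f(w₀^{S₀}) ∈ K_max`
(★ `adelicVal_finAdelicToAdelic_mem_standardMaximalCompactGL`) — the hypothesis `hb₁` of ★ p864821 and the component hypotheses of ★ p865059 (`Φ₃` on `S₀`), ★ p865184 ∕ ★ p865317 (`1` off `S₀`).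
* HEAD **`exists_movedBasePoint`**.
HONEST LABEL: HC_CM is proved only modulo the 7 printed citations (2 remaining named inputs: hLiu418 = `stmt-HodgeConjecture-24832`, h413 = `stmt-HodgeConjecture-24833`) until rung 0
closes; REL ≠ ★ ≠ BUILT; unconditional restricted-product plumbing; asserts no named fact, closes no socket; count-neutral.

## References
* [PlatonovRapinchuk1994] V. Platonov, A. Rapinchuk, *Algebraic Groups and Number Theory* (1994), §5.1.
* [BorelJacquet1979] A. Borel, H. Jacquet, *Automorphic forms and automorphic representations*, Proc. Symp. Pure Math. 33.1 (1979), §4.1.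
* [Rogawski1990] J. D. Rogawski, *Automorphic Representations of Unitary Groups in Three Variables*, Ann. of Math. Stud. 123 (1990), §1.10 p. 9.
-/

set_option autoImplicit false
set_option linter.dupNamespace false  -- the mandated namespace repeats the summit's segment (`HodgeConjecture.HodgeConjecture`)

noncomputable section

open NumberField IsDedekindDomain Filter Set Function
open scoped RestrictedProduct
open Literature.NumberTheory.Automorphic Literature.NumberTheory.Automorphic.UnitaryGroup AdelicGroupData
open Literature.NumberTheory.Automorphic.Arthur2013.Leaves.TECR
open Summit.HodgeConjecture.HodgeConjecture.Cruxes.H413.K2E1ChiGoodInertReadingU3 (mem_local_of_mem_cmLocalForm coe_localGLPiEquiv_apply localGLPiEquiv_apply_mem_valuedCongruenceSubgroup_one)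
open Summit.HodgeConjecture.HodgeConjecture.Cruxes.H413.K2E1BigCellIwasawaTorusEntryU3Letters (antidiag_mem_integralLevel)
open Summit.HodgeConjecture.HodgeConjecture.Cruxes.H413.K2E1BigCellIwasawaTorusEntryU3Witness (exists_antidiag)
open Summit.HodgeConjecture.HodgeConjecture.Cruxes.H413.K2E1FinAdelicBorelLevelLocalGlobalU3 (evalPlace_finAdelicEquiv_symm valuedCongruenceSubgroup_le_glInt)
open Summit.HodgeConjecture.HodgeConjecture.R90.S8 (adelicVal_finAdelicToAdelic_mem_standardMaximalCompactGL)

namespace Summit.HodgeConjecture.HodgeConjecture.Cruxes.H413.K2E1ChiMovedBasePointU3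

variable (L : Type) [Field L] [NumberField L] [IsCMField L]

/-- **THE MOVED BASE POINT `ι_f(w₀^{S₀})` EXISTS.**  For every finite set `S₀` of finite places of `L⁺` there is `b₁ ∈ U(2,1)(𝔸_{L⁺,f})` with: `ι_f(b₁) ∈ K_max` (★ p864821's `hb₁`), `b₁ ∈ U(𝒪̂)`,
component `((b₁)_v)_w = Φ₃` at every `v ∈ S₀`, `w ∣ v` (★ p865059's hypothesis) and `((b₁)_v)_w = 1` at every `v ∉ S₀`, `w ∣ v` (★ p865184's ∕ ★ p865317's hypothesis).
[cite: PlatonovRapinchuk1994, §5.1] [cite: BorelJacquet1979, §4.1] [cite: Rogawski1990, §1.10 p. 9] -/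
theorem exists_movedBasePoint (S₀ : Finset (HeightOneSpectrum (𝓞 ↥(maximalRealSubfield L)))) :
    ∃ b₁ : ↥(finAdelic (↥(maximalRealSubfield L)) L (IsCMField.complexConj L) 3 ((StdForm.antidiagonal 3).over L)),
      finAdelicToAdelic (↥(maximalRealSubfield L)) L (IsCMField.complexConj L) 3 ((StdForm.antidiagonal 3).over L) b₁ ∈
        ((standardMaximalCompactGL 3 L).comap (adelicVal (↥(maximalRealSubfield L)) L (IsCMField.complexConj L) 3 ((StdForm.antidiagonal 3).over L)) :
          Subgroup (quasiSplit (↥(maximalRealSubfield L)) L (IsCMField.complexConj L) 3).Adelic) ∧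
      b₁ ∈ finAdelicIntegralLevel (↥(maximalRealSubfield L)) L (IsCMField.complexConj L) 3 ((StdForm.antidiagonal 3).over L) ∧
      (∀ v ∈ S₀, ∀ w : PlacesOver L v, ((((evalPlace (↥(maximalRealSubfield L)) L (IsCMField.complexConj L) 3 ((StdForm.antidiagonal 3).over L) v b₁ :
          localPi L (IsCMField.complexConj L) 3 ((StdForm.antidiagonal 3).over L) v) : LocalGLPi L 3 v) w : GL (Fin 3) (w.1.adicCompletion L)) : Matrix (Fin 3) (Fin 3) (w.1.adicCompletion L)) =
        !![0, 0, 1; 0, 1, 0; 1, 0, 0]) ∧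
      (∀ v ∉ S₀, ∀ w : PlacesOver L v, ((((evalPlace (↥(maximalRealSubfield L)) L (IsCMField.complexConj L) 3 ((StdForm.antidiagonal 3).over L) v b₁ :
          localPi L (IsCMField.complexConj L) 3 ((StdForm.antidiagonal 3).over L) v) : LocalGLPi L 3 v) w : GL (Fin 3) (w.1.adicCompletion L)) : Matrix (Fin 3) (Fin 3) (w.1.adicCompletion L)) = 1) := by
  classical
  -- the local long Weyl elements `Φ₃ ∈ U(Φ₃)(L⁺_v)` (★ `exists_antidiag`), transported to `localPi v`
  have hW : ∀ v : HeightOneSpectrum (𝓞 ↥(maximalRealSubfield L)), ∃ w₀ : ↥(unitaryGroupOfForm (conjLocal L (IsCMField.complexConj L) v) (cmLocalForm L 3 v)),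
      (w₀ : GL (Fin 3) (LocalRing L v)).val = !![(0 : LocalRing L v), 0, 1; 0, 1, 0; 1, 0, 0] := fun v => exists_antidiag L v
  choose w₀ hw₀ using hW
  set Φ : ∀ v : HeightOneSpectrum (𝓞 ↥(maximalRealSubfield L)), localPi L (IsCMField.complexConj L) 3 ((StdForm.antidiagonal 3).over L) v := fun v =>
    ⟨localGLPiEquiv L 3 v (w₀ v : GL (Fin 3) (LocalRing L v)),
      (localGLPiEquiv_mem_localPi_iff L (IsCMField.complexConj L) 3 ((StdForm.antidiagonal 3).over L) v _).2 (mem_local_of_mem_cmLocalForm L v (w₀ v).2)⟩ with hΦ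
  have hΦint : ∀ v, Φ v ∈ localInt L (IsCMField.complexConj L) 3 ((StdForm.antidiagonal 3).over L) v := fun v =>
    (mem_localInt_iff L (IsCMField.complexConj L) 3 ((StdForm.antidiagonal 3).over L) v _).2 fun w =>
      valuedCongruenceSubgroup_le_glInt L 3 w.1 1 (localGLPiEquiv_apply_mem_valuedCongruenceSubgroup_one L v (antidiag_mem_integralLevel L v (hw₀ v)) w)
  have hΦval : ∀ (v : HeightOneSpectrum (𝓞 ↥(maximalRealSubfield L))) (w : PlacesOver L v), ((((Φ v : localPi L (IsCMField.complexConj L) 3 ((StdForm.antidiagonal 3).over L) v) : LocalGLPi L 3 v) w : GL (Fin 3) (w.1.adicCompletion L)) :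
      Matrix (Fin 3) (Fin 3) (w.1.adicCompletion L)) = !![0, 0, 1; 0, 1, 0; 1, 0, 0] := fun v w => by
    ext i j
    rw [hΦ, coe_localGLPiEquiv_apply, hw₀]
    fin_cases i <;> fin_cases j <;> rfl
  -- the family: `Φ₃` on `S₀`, `1` off `S₀`; integral everywhere, hence a restricted-product point
  set x : ∀ v : HeightOneSpectrum (𝓞 ↥(maximalRealSubfield L)), localPi L (IsCMField.complexConj L) 3 ((StdForm.antidiagonal 3).over L) v := fun v => if v ∈ S₀ then Φ v else 1 with hx
  have hxint : ∀ v, x v ∈ localInt L (IsCMField.complexConj L) 3 ((StdForm.antidiagonal 3).over L) v := fun v => by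
    by_cases hv : v ∈ S₀
    · rw [hx]; dsimp only; rw [if_pos hv]; exact hΦint v
    · rw [hx]; dsimp only; rw [if_neg hv]; exact Subgroup.one_mem _
  set X : Πʳ v : HeightOneSpectrum (𝓞 ↥(maximalRealSubfield L)), [localPi L (IsCMField.complexConj L) 3 ((StdForm.antidiagonal 3).over L) v, localInt L (IsCMField.complexConj L) 3 ((StdForm.antidiagonal 3).over L) v] :=
    RestrictedProduct.mk (fun v => x v) (Filter.Eventually.of_forall hxint) with hX
  set b₁ : ↥(finAdelic (↥(maximalRealSubfield L)) L (IsCMField.complexConj L) 3 ((StdForm.antidiagonal 3).over L)) :=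
    (finAdelicEquiv (↥(maximalRealSubfield L)) L (IsCMField.complexConj L) 3 ((StdForm.antidiagonal 3).over L)).symm X with hb₁
  have hbv : ∀ v, evalPlace (↥(maximalRealSubfield L)) L (IsCMField.complexConj L) 3 ((StdForm.antidiagonal 3).over L) v b₁ = x v := fun v => by
    rw [hb₁, evalPlace_finAdelicEquiv_symm, hX, RestrictedProduct.mk_apply]
  have hint : b₁ ∈ finAdelicIntegralLevel (↥(maximalRealSubfield L)) L (IsCMField.complexConj L) 3 ((StdForm.antidiagonal 3).over L) := by
    rw [mem_finAdelicIntegralLevel_iff_forall]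
    intro v
    rw [hb₁, ContinuousMulEquiv.apply_symm_apply, hX, RestrictedProduct.mk_apply]
    exact hxint v
  refine ⟨b₁, Subgroup.mem_comap.2 (adelicVal_finAdelicToAdelic_mem_standardMaximalCompactGL L hint), hint, fun v hv w => ?_, fun v hv w => ?_⟩
  · rw [hbv v, hx]; dsimp only; rw [if_pos hv]; exact hΦval v w
  · rw [hbv v, hx]; dsimp only; rw [if_neg hv, OneMemClass.coe_one, Pi.one_apply, Units.val_one]

end Summit.HodgeConjecture.HodgeConjecture.Cruxes.H413.K2E1ChiMovedBasePointU3

end
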